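import Literature.MathematicalPhysics.KineticTheory.SiteChainHormander
import Literature.MathematicalPhysics.KineticTheory.LangevinSemigroup
import HarnessLib

/-!
# Site-inhomogeneous Langevin chains: Hörmander's bracket condition (CEHRB Prop. 4.1) and smooth densities

Topic `Literature/MathematicalPhysics/KineticTheory`, grouping namespace `…KineticTheory.HeatConduction`.
Continuation of `SiteChainHormander.lean` (twin of the bracket half of `LangevinChainHormander.lean`
for the site-dependent chains `SiteChain` of `CellChain.lean`): Cuneo–Eckmann–Hairer–Rey-Bellet 2018,
Proposition 4.1 ("Under Conditions C1 and C2, the system (2.2) satisfies H1") for the oscillator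
network on the PATH GRAPH with site-dependent pinning `U_i`, bond potentials `V_i` and baths at both
ends, in the uniformly non-degenerate case `V_i'' ≠ 0` on every bond (C2 with `ℓ = 1`), and its
consequence through Hörmander's Theorem 1.1: weakly stationary measures have smooth densities.

* `SiteChain.langevinBracketSeq_triangular` — ranking the coordinate directions
  `∂_{p_0} ≺ ∂_{q_0} ≺ ∂_{p_1} ≺ ∂_{q_1} ≺ ⋯`, the bracket `Z_k = [X₀, [X₀, …, X_L]]` has vanishing
  coordinates of rank `> k` and a NOWHERE-vanishing coordinate of rank `k`
  (`±√(γT_L) ∏_{j<i} V_j''(q_{j+1} - q_j)`): the chain version of the printed induction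
  ("`[∂_{p_v}, X̄_0] = -∂_{q_v} + γ_v ∂_{p_v}` … `∇_{p_v} ∈ M ⇒ ∇_{q_v} ∈ M`" and the commutator
  formula with the non-degeneracy of `V_e`), the only place where `V_i'' ≠ 0` enters;
* `SiteChain.isBracketGenerating_langevinHormanderFamily` — **CEHRB Prop. 4.1 for site chains,
  PROVED**: smooth `U_i, V_i`, `V_i'' ≠ 0` for all `i`, `γ T_L > 0` (the chain is controlled by its
  left end, C1); every `N ≥ 1`, all `T_R`;
* `SiteChain.hasSmoothDensity_of_integral_generator_eq_zero` — hence, from Hörmander's Theorem 1.1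
  (`Literature.Analysis.Distribution.Hormander1967_thm11`, the hypothesis `hH`; proved in the tree as
  `Literature.Analysis.Hypoelliptic.hormander1967_thm11_proof`), every finite Borel measure `μ` with
  `∫ L f dμ = 0` for all `f ∈ C_c^∞` has a smooth density (`ᵗ(L*) = L`,
  `SiteChain.hormanderTranspose_eq_generator`) — CEHRB Prop. 3.2, last sentence, for such chains;
  `SiteChain.hasSmoothDensity_of_isSteadyState` for weak steady states (`SiteChain.IsSteadyState`);
* `cellChain_hasSmoothDensity_of_isSteadyState` — the instance for the CELL CHAINS
  `cellChain ω₂ lam β γ c` of `CellChain.lean` (`β ≥ 0`, `γ > 0`, any cell indicator `c`): every bond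
  has `V_i''(r) = 1 + 3β_i r² ≥ 1`, `β_i ∈ {0, β}`.

## References

* N. Cuneo, J.-P. Eckmann, M. Hairer, L. Rey-Bellet, *Non-equilibrium steady states for networks of
  oscillators*, Electron. J. Probab. **23** (2018) no. 55 (arXiv:1712.09413): §3 (H1), Prop. 3.2,
  Prop. 4.1 and its proof (arXiv p. 10).
* L. Hörmander, *Hypoelliptic second order differential equations*, Acta Math. **119** (1967)
  147–171, Thm 1.1.

## Design choices

* Only the ITERATED brackets `[X₀, [X₀, …, X_L]]` are needed when `V_i'' ≠ 0` everywhere; the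
  degenerate case (RB-non-degenerate `V_i`, germ modules) of `LangevinChainDegenerateHormander.lean` is
  not twinned here.
* Hörmander's theorem enters as the hypothesis `hH : Hormander1967_thm11` (keeps the import light);
  consumers discharge it with `hormander1967_thm11_proof`.
-/

noncomputable section

open MeasureTheory Filter Topology Set Function Finset
open scoped ContDiff NNReal ENNReal

namespace Literature.MathematicalPhysics.KineticTheory.HeatConduction

open Literature.MathematicalPhysics.KineticTheory Literature.Analysis.Distribution

variable {N : ℕ}

namespace SiteChain

variable (P : SiteChain)

/-! ### CEHRB Proposition 4.1: the triangular structure of the brackets -/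

/-- **The triangular structure of the brackets** (CEHRB, proof of Prop. 4.1, for the site chain):
with the coordinate directions ranked `p_0 ≺ q_0 ≺ p_1 ≺ q_1 ≺ ⋯` (rank `2i` for `p_i`, `2i+1` for
`q_i`), the bracket `Z_k = [X₀, [X₀, …, X_L]]` has identically vanishing coordinates of rank `> k`,
and its rank-`k` coordinate vanishes NOWHERE: it is `±√(γT_L) ∏_{j<i} V_j''(q_{j+1} - q_j)` over
the bonds crossed, and every `V_j'' ≠ 0`. [cite: CuneoEckmannHairerReyBellet2018, Prop 4.1] -/
theorem langevinBracketSeq_triangular (hU : ∀ i, ContDiff ℝ ∞ (P.U i))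
    (hV : ∀ i, ContDiff ℝ ∞ (P.V i)) (hN : 0 < N) {T_L : ℝ} (T_R : ℝ) (hγL : 0 < P.γ * T_L)
    (hV2 : ∀ i r, deriv (deriv (P.V i)) r ≠ 0) (k : ℕ) :
    (∀ i : Fin N, k < 2 * i.val → ∀ x, (P.langevinBracketSeq hN T_L T_R k x).2 i = 0) ∧
    (∀ i : Fin N, k < 2 * i.val + 1 → ∀ x, (P.langevinBracketSeq hN T_L T_R k x).1 i = 0) ∧
    (∀ i : Fin N, k = 2 * i.val → ∀ x, (P.langevinBracketSeq hN T_L T_R k x).2 i ≠ 0) ∧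
    (∀ i : Fin N, k = 2 * i.val + 1 → ∀ x, (P.langevinBracketSeq hN T_L T_R k x).1 i ≠ 0) := by
  induction k with
  | zero =>
    have h0 := P.langevinBracketSeq_zero_apply hN T_L T_R
    refine ⟨fun i hi x => ?_, fun i _ x => ?_, fun i hi x => ?_, fun i hi _ => ?_⟩
    · have hi0 : i ≠ ⟨0, hN⟩ := by intro e; subst e; simp at hi
      simp [h0, hi0]
    · simp [h0]
    · have hi0 : i = ⟨0, hN⟩ := Fin.ext (by change i.val = 0; omega)
      subst hi0
      simp [h0, Real.sqrt_ne_zero'.2 hγL]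
    · omega
  | succ k ih =>
    obtain ⟨h2, h3, h4, h5⟩ := ih
    have hrec := P.langevinBracketSeq_succ_apply hN T_L T_R k
    -- components of the recursion `Z_{k+1} = DZ_k·X₀ - DX₀·Z_k`
    have hfst : ∀ x i, (P.langevinBracketSeq hN T_L T_R (k + 1) x).1 i =
        (fderiv ℝ (P.langevinBracketSeq hN T_L T_R k) x (P.adjointLangevinDrift N x)).1 i +
          (P.langevinBracketSeq hN T_L T_R k x).2 i := fun x i => by
      rw [hrec, P.fderiv_adjointLangevinDrift_apply hU hV]
      simp only [Prod.fst_sub, Pi.sub_apply, Pi.neg_apply, sub_neg_eq_add]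
    have hsnd : ∀ x i, (P.langevinBracketSeq hN T_L T_R (k + 1) x).2 i =
        (fderiv ℝ (P.langevinBracketSeq hN T_L T_R k) x (P.adjointLangevinDrift N x)).2 i -
          ((∑ j, P.d2Potential N i j x.1 * (P.langevinBracketSeq hN T_L T_R k x).1 j) +
            P.γ * OscillatorChain.bathWeight N i * (P.langevinBracketSeq hN T_L T_R k x).2 i) :=
      fun x i => by
      rw [hrec, P.fderiv_adjointLangevinDrift_apply hU hV, Prod.snd_sub, Pi.sub_apply]
    refine ⟨fun i hi x => ?_, fun i hi x => ?_, fun i hi x => ?_, fun i hi x => ?_⟩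
    · -- vanishing of the `p_i` coordinate for `k + 1 < 2 i`
      rw [hsnd, fderiv_apply_snd_eq_zero (h2 i (by omega)), h2 i (by omega) x, mul_zero,
        add_zero, zero_sub, neg_eq_zero]
      refine Finset.sum_eq_zero fun j _ => ?_
      by_cases hj : k < 2 * j.val + 1
      · rw [h3 j hj x, mul_zero]
      · rw [P.d2Potential_eq_zero_of_le N (by omega) x.1, zero_mul]
    · -- vanishing of the `q_i` coordinate for `k + 1 < 2 i + 1`
      rw [hfst, fderiv_apply_fst_eq_zero (h3 i (by omega)), h2 i (by omega) x, add_zero]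
    · -- non-vanishing of the `p_i` coordinate for `k + 1 = 2 i` (`i ≥ 1`)
      have hi1 : 1 ≤ i.val := by omega
      set i' : Fin N := ⟨i.val - 1, by omega⟩ with hi'
      rw [hsnd, fderiv_apply_snd_eq_zero (h2 i (by omega)), h2 i (by omega) x, mul_zero,
        add_zero, zero_sub, neg_ne_zero, Finset.sum_eq_single_of_mem i' (mem_univ _)]
      · refine mul_ne_zero ?_ (h5 i' (by simp [hi']; omega) x)
        rw [P.d2Potential_succ N (by simp [hi']; omega)]
        exact neg_ne_zero.2 (hV2 _ _)
      · intro j _ hj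
        by_cases hjk : k < 2 * j.val + 1
        · rw [h3 j hjk x, mul_zero]
        · have : j.val + 2 ≤ i.val := by
            have : j.val ≠ i.val - 1 := fun e => hj (Fin.ext (by simp [hi', e]))
            omega
          rw [P.d2Potential_eq_zero_of_le N this x.1, zero_mul]
    · -- non-vanishing of the `q_i` coordinate for `k + 1 = 2 i + 1`
      rw [hfst, fderiv_apply_fst_eq_zero (h3 i (by omega)), zero_add]
      exact h4 i (by omega) x

/-- **Cuneo–Eckmann–Hairer–Rey-Bellet 2018, Proposition 4.1, for site chains, PROVED** ("Under
Conditions C1 and C2, the system (2.2) satisfies H1"): for a site chain with smooth potentials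
`U_i, V_i`, nowhere-vanishing `V_i''` on every bond (non-degenerate interactions, C2 with `ℓ = 1`)
and a genuine left bath (`γ T_L > 0`; the path graph is controlled by one end, C1), the iterated
brackets of `X₀ = -Y` with `X_L = √(γT_L) ∂_{p_0}` span the whole phase space at every point —
Hörmander's bracket condition for `L*`. [cite: CuneoEckmannHairerReyBellet2018, Prop 4.1] -/
theorem isBracketGenerating_langevinHormanderFamily (hU : ∀ i, ContDiff ℝ ∞ (P.U i))
    (hV : ∀ i, ContDiff ℝ ∞ (P.V i)) (hN : 0 < N) {T_L : ℝ} (T_R : ℝ) (hγL : 0 < P.γ * T_L)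
    (hV2 : ∀ i r, deriv (deriv (P.V i)) r ≠ 0) :
    IsBracketGenerating (P.langevinHormanderFamily hN T_L T_R) univ := by
  intro x _
  set S : Submodule ℝ (PhaseSpace N) := Submodule.span ℝ
    {v | ∃ V, IsIteratedLieBracket (P.langevinHormanderFamily hN T_L T_R) V ∧ V x = v} with hS
  have hZ : ∀ k, S.mkQ (P.langevinBracketSeq hN T_L T_R k x) = 0 := fun k => by
    rw [Submodule.mkQ_apply, Submodule.Quotient.mk_eq_zero]
    exact Submodule.subset_span ⟨_, P.isIteratedLieBracket_langevinBracketSeq hN T_L T_R k, rfl⟩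
  have hT := P.langevinBracketSeq_triangular hU hV hN T_R hγL hV2
  -- every coordinate vector is in `S`, by strong induction on the site index
  have key : ∀ m : ℕ, ∀ i : Fin N, i.val = m → S.mkQ (unitP i) = 0 ∧ S.mkQ (unitQ i) = 0 := by
    intro m
    induction m using Nat.strong_induction_on with
    | _ m ih =>
      intro i him
      -- expand `Z_k x` in coordinates and push through the quotient map
      have hexp : ∀ k, (∑ j, (P.langevinBracketSeq hN T_L T_R k x).1 j • S.mkQ (unitQ j)) +
          ∑ j, (P.langevinBracketSeq hN T_L T_R k x).2 j • S.mkQ (unitP j) = 0 := fun k => by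
        have := hZ k
        rw [eq_sum_unitQ_add_sum_unitP (P.langevinBracketSeq hN T_L T_R k x)] at this
        simpa only [map_add, map_sum, map_smul] using this
      -- the `p_i` direction, from `Z_{2m}`
      have hPi : S.mkQ (unitP i) = 0 := by
        obtain ⟨h2, h3, h4, -⟩ := hT (2 * m)
        have e := hexp (2 * m)
        rw [Finset.sum_eq_zero, zero_add, Finset.sum_eq_single_of_mem i (mem_univ _)] at e
        · exact (smul_eq_zero.1 e).resolve_left (h4 i (by omega) x)
        · intro j _ hj
          by_cases hjm : 2 * m < 2 * j.val
          · rw [h2 j hjm x, zero_smul]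
          · rw [(ih j.val (by have : j.val ≠ m := fun e => hj (Fin.ext (by omega)); omega)
              j rfl).1, smul_zero]
        · intro j _
          by_cases hjm : 2 * m < 2 * j.val + 1
          · rw [h3 j hjm x, zero_smul]
          · rw [(ih j.val (by omega) j rfl).2, smul_zero]
      refine ⟨hPi, ?_⟩
      -- the `q_i` direction, from `Z_{2m+1}`
      obtain ⟨h2, h3, -, h5⟩ := hT (2 * m + 1)
      have e := hexp (2 * m + 1)
      rw [Finset.sum_eq_single_of_mem i (mem_univ _), Finset.sum_eq_zero, add_zero] at e
      · exact (smul_eq_zero.1 e).resolve_left (h5 i (by omega) x)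
      · intro j _
        by_cases hjm : 2 * m + 1 < 2 * j.val
        · rw [h2 j hjm x, zero_smul]
        · rcases Nat.lt_or_ge j.val m with hlt | hge
          · rw [(ih j.val hlt j rfl).1, smul_zero]
          · have : j = i := Fin.ext (by omega)
            rw [this, hPi, smul_zero]
      · intro j _ hj
        by_cases hjm : 2 * m + 1 < 2 * j.val + 1
        · rw [h3 j hjm x, zero_smul]
        · rw [(ih j.val (by have : j.val ≠ m := fun e => hj (Fin.ext (by omega)); omega)
            j rfl).2, smul_zero]
  -- conclude `S = ⊤`
  have hmem : ∀ v, S.mkQ v = 0 → v ∈ S := fun v hv => by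
    rwa [Submodule.mkQ_apply, Submodule.Quotient.mk_eq_zero] at hv
  rw [eq_top_iff]
  rintro v -
  rw [eq_sum_unitQ_add_sum_unitP v]
  exact add_mem (Submodule.sum_mem _ fun i _ => Submodule.smul_mem _ _ (hmem _ (key _ i rfl).2))
    (Submodule.sum_mem _ fun i _ => Submodule.smul_mem _ _ (hmem _ (key _ i rfl).1))

/-! ### Smooth densities of weakly stationary measures -/

/-- **CEHRB Prop. 3.2 (last sentence) for site chains with non-degenerate bonds, from Hörmander's
Theorem 1.1**: for smooth sitewise potentials with `V_i'' ≠ 0` everywhere, `γ > 0`, `N ≥ 1`,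
`T_L > 0`, `T_R ≥ 0`, a finite Borel measure `μ` on phase space with `∫ L f dμ = 0` for all
`f ∈ C_c^∞` is, read as a distribution, a solution of `L* μ = 0`
(`⟨L*μ, φ⟩ = ∫ Lφ dμ = 0`, `SiteChain.hormanderTranspose_eq_generator`), where
`L* = X_L² + X_R² + X₀ + 2γ` is of Hörmander's form (1.6) and satisfies the bracket condition
everywhere (`isBracketGenerating_langevinHormanderFamily`); by Theorem 1.1 (the hypothesis `hH`)
`μ` has a smooth density. [cite: Hormander1967, Thm 1.1]
[cite: CuneoEckmannHairerReyBellet2018, Prop 3.2 and Prop 4.1] -/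
theorem hasSmoothDensity_of_integral_generator_eq_zero (hH : Hormander1967_thm11)
    (hU : ∀ i, ContDiff ℝ ∞ (P.U i)) (hV : ∀ i, ContDiff ℝ ∞ (P.V i))
    (hV2 : ∀ i r, deriv (deriv (P.V i)) r ≠ 0) (hγ : 0 < P.γ) (hN : 0 < N) {T_L T_R : ℝ}
    (hL : 0 < T_L) (hR : 0 ≤ T_R) (μ : Measure (PhaseSpace N)) [IsFiniteMeasure μ]
    (hstat : ∀ f : PhaseSpace N → ℝ, ContDiff ℝ ∞ f → HasCompactSupport f →
      ∫ x, P.generator N T_L T_R f x ∂μ = 0) :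
    HasSmoothDensity μ := by
  have hγL : 0 < P.γ * T_L := mul_pos hγ hL
  haveI := isAddHaarMeasure_volume_phaseSpace N
  obtain ⟨g, hg, hg0, hμg⟩ := hH.exists_eq_withDensity (volume : Measure (PhaseSpace N))
    (X₀ := P.adjointLangevinDrift N) (X := P.langevinBathField hN T_L T_R) (c := fun _ => 2 * P.γ)
    (P.contDiff_adjointLangevinDrift hU hV N) (fun _ => contDiff_const) contDiff_const
    (P.isBracketGenerating_langevinHormanderFamily hU hV hN T_R hγL hV2) μ
    (fun φ hφ hφc => by
      rw [P.hormanderTranspose_eq_generator hU hV hN hγL.le (mul_nonneg hγ.le hR) hφ]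
      exact hstat φ hφ hφc)
  exact ⟨g, hg, hg0, hμg⟩

/-- Hence **every weak steady state (`SiteChain.IsSteadyState`) of such a site chain has a smooth
density** (smooth `U_i, V_i`, `V_i'' ≠ 0`, `γ > 0`, `N ≥ 1`, `T_L > 0`, `T_R ≥ 0`).
[cite: Hormander1967, Thm 1.1] [cite: CuneoEckmannHairerReyBellet2018, Prop 3.2 and Prop 4.1] -/
theorem hasSmoothDensity_of_isSteadyState (hH : Hormander1967_thm11)
    (hU : ∀ i, ContDiff ℝ ∞ (P.U i)) (hV : ∀ i, ContDiff ℝ ∞ (P.V i))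
    (hV2 : ∀ i r, deriv (deriv (P.V i)) r ≠ 0) (hγ : 0 < P.γ) (hN : 0 < N) {T_L T_R : ℝ}
    (hL : 0 < T_L) (hR : 0 ≤ T_R) {μ : Measure (PhaseSpace N)}
    (hμ : P.IsSteadyState N T_L T_R μ) : HasSmoothDensity μ := by
  obtain ⟨hprob, hstat, -⟩ := hμ
  exact P.hasSmoothDensity_of_integral_generator_eq_zero hH hU hV hV2 hγ hN hL hR μ hstat

end SiteChain

/-! ### Cell chains -/

/-- **Weak steady states of a cell chain have smooth densities** (given Hörmander's Theorem 1.1 as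
`hH`): for `cellChain ω₂ lam β γ c` (`β ≥ 0`, `γ > 0`, any `ω₂, lam`, any cell indicator `c`),
`N ≥ 1`, `T_L > 0`, `T_R ≥ 0`, the potentials are smooth polynomials and every bond has
`V_i''(r) = 1 + 3β_i r² ≥ 1` with `β_i ∈ {0, β}`, so `SiteChain.hasSmoothDensity_of_isSteadyState`
applies. [cite: CuneoEckmannHairerReyBellet2018, Prop 3.2 and Prop 4.1] -/
theorem cellChain_hasSmoothDensity_of_isSteadyState (hH : Hormander1967_thm11) {ω₂ lam β γ : ℝ}
    (hβ : 0 ≤ β) (hγ : 0 < γ) (c : ℕ → Bool) (hN : 0 < N) {T_L T_R : ℝ} (hL : 0 < T_L)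
    (hR : 0 ≤ T_R) {μ : Measure (PhaseSpace N)}
    (hμ : (cellChain ω₂ lam β γ c).IsSteadyState N T_L T_R μ) : HasSmoothDensity μ := by
  have hU : ∀ i, ContDiff ℝ ∞ ((cellChain ω₂ lam β γ c).U i) := fun i => by
    rw [cellChain_U]; exact pinnedChain_contDiff_U _ _ _ _
  have hV : ∀ i, ContDiff ℝ ∞ ((cellChain ω₂ lam β γ c).V i) := fun i => by
    rw [cellChain_V]; exact pinnedChain_contDiff_V _ _ _ _
  have hV2 : ∀ i r, deriv (deriv ((cellChain ω₂ lam β γ c).V i)) r ≠ 0 := fun i r => by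
    have hb : 0 ≤ (if c i then β else 0 : ℝ) := by split_ifs <;> simp [hβ]
    rw [cellChain_V, pinnedChain_deriv_deriv_V]
    positivity
  exact (cellChain ω₂ lam β γ c).hasSmoothDensity_of_isSteadyState hH hU hV hV2 hγ hN hL hR hμ

end Literature.MathematicalPhysics.KineticTheory.HeatConduction
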